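import Summits.Parity.BatemanHorn.Theorems.SoloInformedPolynomialUpperBoundSieve
import Summits.Parity.BatemanHorn.Theorems.SoloInformedRootCountSieveCondition
import Summits.Parity.BatemanHorn.Theorems.SoloInformedQuadraticPrimeCount
import Literature.NumberTheory.Sieve.PolynomialCongruencesMeanValues
import Literature.Barriers.Parity.UniformBatemanHornBunyakovsky

/-!
# The upper-bound sieve for the rough values of ONE Bateman–Horn polynomial of any degree

Solo unit `solo-Parity-informed` (ideation tier, informed mode), session 13; `PLAN.md` §21, CLAIMS C58.

For one polynomial `g ∈ ℤ[X]` of degree `d ≥ 2` forming a Bateman–Horn system this file proves,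
unconditionally and for EVERY degree,

* `exists_level_eventually_card_rough_le` — for every `δ > 0` there is a level exponent `0 < c < 1`
  with `#{1 ≤ n ≤ N : |g(n)| has no prime factor < N^c} ≤ (2 C(g) + δ) N / log N` for all large `N`
  (Halberstam–Richert, *Sieve Methods*, Thm 5.3 with the Jurkat–Richert constant `F(1) = 2e^γ` at level
  `N^{1-o(1)}`); the prime-count and Chebyshev-function consequences are in
  `SoloInformedPolynomialUpperBound`.

Session 12 had this for `d = 2` only, because the one-sided sieve condition was available only for
quadratics; `SoloInformedRootCountSieveCondition` now supplies it for every `g` (from the bounded-error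
Mertens theorem for `ρ_g`, Landau's prime ideal theorem). The rest is the session-12 argument: a
translate `f(X) = g(X + n₀)` with `f(n) > n` (`n ≥ 1`), same root counts
(`Literature.Barriers.Parity.polyRootCountMod_comp_X_add_C`), the Jurkat–Richert bound for the sifted
set of `{f(n) : n ≤ N}` (`card_roughValues_le_sieve`, the rough-values form of
`card_primeValues_le_sieve`), remainders summed by `∑_{m ≤ y} ρ_g(m) ≪ y`
(`exists_sum_rootCount_le`), and the main term from the Bateman–Horn Mertens product.

References: H. Halberstam, H.-E. Richert, *Sieve Methods* (Academic Press 1974) Thm 5.3; W. B. Jurkat,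
H.-E. Richert, Acta Arith. 11 (1965) 217–240; P. T. Bateman, R. A. Horn, Math. Comp. 16 (1962) 363–367
[BatemanHorn1962].
-/

namespace Summit.Parity.BatemanHorn.Theorems

open Finset Filter Asymptotics Polynomial
open scoped Topology
open Literature.NumberTheory.Sieve (polyRootCountMod IsBatemanHornSystem batemanHornConst polyPrimeCount
  exists_sum_rootCount_le primesProdBelow squarefree_primesProdBelow primeFactors_primesProdBelow
  dvd_primesProdBelow_iff polyAPSeq polyAPSeq_sifted polyAPSeq_size polyAPSeq_density
  polyAPSeq_densityProduct rootDensity_apply abs_remainder_polyAPSeq_le apIndex mem_apIndex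
  sum_filter_polyAPSeq_a_eq_card SieveSequence)
open Literature.NumberTheory.Sieve.BatemanHornMertens (rootCount_single_lt)
open Literature.Barriers.Parity (polyRootCountMod_comp_X_add_C irreducible_comp_X_add_C)

/-! ### A good translate -/

/-- For `g` of degree `≥ 2` with positive leading coefficient, `g(n) > n` for all large `n`
(`g - X` has the same degree and leading coefficient). -/
theorem exists_shift_lt_eval {g : ℤ[X]} (hdeg : 2 ≤ g.natDegree) (hlc : 0 < g.leadingCoeff) :
    ∃ n₀ : ℕ, ∀ n : ℕ, n₀ ≤ n → (n : ℤ) < g.eval (n : ℤ) := by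
  have hX : (X : ℤ[X]).natDegree < g.natDegree := by rw [natDegree_X]; omega
  have hdeg' : 0 < (g - X).natDegree := by
    rw [natDegree_sub_eq_left_of_natDegree_lt hX]; omega
  have hlc' : 0 < (g - X).leadingCoeff := by
    rwa [leadingCoeff_sub_of_degree_lt (degree_lt_degree hX)]
  obtain ⟨n₀, hn₀⟩ := exists_eval_natCast_pos hdeg' hlc'
  refine ⟨n₀, fun n hn => ?_⟩
  have h := hn₀ n hn
  rw [eval_sub, eval_X] at h
  linarith

/-- Counting through a shift: if `f(m) = g(m + n₀)` then
`#{1 ≤ n ≤ N : Q(|g(n)|)} ≤ #{1 ≤ m ≤ N : Q(|f(m)|)} + n₀`. -/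
theorem card_filter_le_card_filter_shift_add {f g : ℤ[X]} {n₀ : ℕ}
    (hfg : ∀ m : ℕ, f.eval (m : ℤ) = g.eval ((m + n₀ : ℕ) : ℤ)) (Q : ℕ → Prop) [DecidablePred Q]
    (N : ℕ) :
    #((Icc 1 N).filter fun n : ℕ => Q (g.eval (n : ℤ)).natAbs) ≤
      #((Icc 1 N).filter fun m : ℕ => Q (f.eval (m : ℤ)).natAbs) + n₀ := by
  calc #((Icc 1 N).filter fun n : ℕ => Q (g.eval (n : ℤ)).natAbs)
      ≤ #((((Icc 1 N).filter fun m : ℕ => Q (f.eval (m : ℤ)).natAbs).image fun m : ℕ => m + n₀)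
          ∪ Icc 1 n₀) := by
        refine card_le_card fun n hn => ?_
        rw [mem_filter, mem_Icc] at hn
        obtain ⟨⟨hn1, hnN⟩, hQ⟩ := hn
        rw [mem_union, mem_image, mem_Icc]
        rcases Nat.lt_or_ge n₀ n with h | h
        · refine Or.inl ⟨n - n₀, mem_filter.mpr ⟨mem_Icc.mpr ⟨by omega, by omega⟩, ?_⟩, by omega⟩
          rwa [hfg, show n - n₀ + n₀ = n by omega]
        · exact Or.inr ⟨hn1, h⟩
    _ ≤ #((((Icc 1 N).filter fun m : ℕ => Q (f.eval (m : ℤ)).natAbs).image fun m : ℕ => m + n₀))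
          + #(Icc 1 n₀) := card_union_le _ _
    _ ≤ _ := by
        rw [Nat.card_Icc, Nat.add_sub_cancel]
        exact Nat.add_le_add_right card_image_le _

/-! ### The Jurkat–Richert bound for the sifted set of `{f(n) : n ≤ N}` -/

/-- **The Jurkat–Richert bound for the rough values of `f`.** As `card_primeValues_le_sieve`, but for
the sifted set itself: for `f ∈ ℤ[X]` with `ρ_f(p) < p` and `f(n) ≥ n` (`n ≥ 1`), `0 < ε < 1/200`,
`z ≥ 2`, the primes `< u₁` exempted, and `∑_{m ≤ y} ρ_f(m) ≤ C y` (`y ≥ 2`):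
`#{1 ≤ n ≤ N : (|f(n)|, P(z)) = 1} ≤ (2e^γ + ε e^{13}) ∏_{p<z} (1 - ρ_f(p)/p) · N + C z ∏_{p<u₁} p`. -/
theorem card_roughValues_le_sieve (f : ℤ[X]) (hlt : ∀ p : ℕ, p.Prime → polyRootCountMod ![f] p < p)
    (hval : ∀ n : ℕ, 1 ≤ n → (n : ℤ) ≤ f.eval (n : ℤ))
    {ε u₁ z C : ℝ} (hε : 0 < ε) (hε' : ε < 1 / 200) (hz : 2 ≤ z) (N : ℕ)
    (hM : (polyAPSeq f N 1 0).HasMertensHypothesisBelow (primesProdBelow z)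
      ((Nat.primesBelow ⌈z⌉₊).filter fun p : ℕ => (p : ℝ) < u₁) ε z)
    (hC : ∀ y : ℝ, 2 ≤ y → ∑ m ∈ Icc 1 ⌊y⌋₊, (polyRootCountMod ![f] m : ℝ) ≤ C * y) :
    (#((Icc 1 N).filter fun n : ℕ => ((f.eval (n : ℤ)).natAbs).Coprime (primesProdBelow z)) : ℝ) ≤
      (2 * Real.exp Real.eulerMascheroniConstant + ε * Real.exp 13) *
          ((∏ p ∈ Nat.primesBelow ⌈z⌉₊, (1 - (polyRootCountMod ![f] p : ℝ) / p)) * N)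
        + C * (z * ((∏ p ∈ Nat.primesBelow ⌈u₁⌉₊, p : ℕ) : ℝ)) := by
  set Q := (Nat.primesBelow ⌈z⌉₊).filter fun p : ℕ => (p : ℝ) < u₁ with hQ
  set x : ℝ := (((Icc 1 N).sup fun n : ℕ => (f.eval (n : ℤ)).toNat : ℕ) : ℝ) with hx
  have hz0 : 0 ≤ z := by linarith
  have hlogz : 0 < Real.log z := Real.log_pos (by linarith)
  have hIdx : apIndex N 1 0 = Icc 1 N := by
    ext n
    rw [mem_apIndex, mem_Icc]
    constructor
    · rintro ⟨⟨h1, h2⟩, -⟩; exact ⟨by omega, h2⟩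
    · rintro ⟨h1, h2⟩; exact ⟨⟨by omega, h2⟩, Nat.modEq_one⟩
  have hpos : ∀ n : ℕ, 1 ≤ n → 0 < f.eval (n : ℤ) := fun n hn =>
    lt_of_lt_of_le (by exact_mod_cast hn) (hval n hn)
  -- the values on the index set are positive and `≤ x`
  have hxval : ∀ n ∈ apIndex N 1 0, 0 < f.eval (n : ℤ) ∧ ((f.eval (n : ℤ) : ℤ) : ℝ) ≤ x := by
    intro n hn
    rw [hIdx] at hn
    have hn1 : 1 ≤ n := (mem_Icc.mp hn).1
    refine ⟨hpos n hn1, ?_⟩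
    have h1 : f.eval (n : ℤ) ≤ (((f.eval (n : ℤ)).toNat : ℕ) : ℤ) := Int.self_le_toNat _
    have h2 : (f.eval (n : ℤ)).toNat ≤ (Icc 1 N).sup fun n : ℕ => (f.eval (n : ℤ)).toNat :=
      le_sup (f := fun n : ℕ => (f.eval (n : ℤ)).toNat) hn
    have h1' : ((f.eval (n : ℤ) : ℤ) : ℝ) ≤ (((f.eval (n : ℤ)).toNat : ℕ) : ℝ) := by exact_mod_cast h1
    have h2' : (((f.eval (n : ℤ)).toNat : ℕ) : ℝ) ≤ x := by rw [hx]; exact_mod_cast h2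
    exact h1'.trans h2'
  -- hypotheses of the Jurkat–Richert theorem
  have h01 : ∀ p ∈ (primesProdBelow z).primeFactors,
      0 ≤ (polyAPSeq f N 1 0).density p ∧ (polyAPSeq f N 1 0).density p < 1 := by
    intro p hp
    have hpr : p.Prime := Nat.prime_of_mem_primeFactors hp
    rw [polyAPSeq_density, rootDensity_apply]
    refine ⟨by positivity, ?_⟩
    rw [div_lt_one (by exact_mod_cast hpr.pos)]
    exact_mod_cast hlt p hpr
  have hQsub : Q ⊆ (primesProdBelow z).primeFactors := by
    rw [primeFactors_primesProdBelow]; exact filter_subset _ _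
  have hs : Real.log z / Real.log z = 1 := div_self hlogz.ne'
  have hX : (polyAPSeq f N 1 0).size x = N := by rw [polyAPSeq_size]; simp
  have hsize : (polyAPSeq f N 1 0).size x = ∑ n ∈ Ioc 0 ⌊x⌋₊, (polyAPSeq f N 1 0).a n := by
    have h := sum_filter_polyAPSeq_a_eq_card f N 1 0 hxval (fun _ => True)
    rw [Finset.filter_true, Finset.filter_true, hIdx, Nat.card_Icc, Nat.add_sub_cancel] at h
    rw [h, hX]
  have hJR := Literature.NumberTheory.Sieve.LinearSieve.jurkatRichert_upper_allLevels_holds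
    (polyAPSeq f N 1 0) x (primesProdBelow z) Q ε z z (squarefree_primesProdBelow z) dvd_rfl h01
    hQsub hε hε' hz le_rfl (by rw [hs]; norm_num) hsize hM
  rw [hs, div_one, show (14 : ℝ) - 1 = 13 by norm_num] at hJR
  -- the sifted count
  have hsift : (polyAPSeq f N 1 0).sifted x (primesProdBelow z) =
      #((Icc 1 N).filter fun n : ℕ => (f.eval (n : ℤ)).natAbs.Coprime (primesProdBelow z)) := by
    rw [polyAPSeq_sifted f N 1 0 hxval, hIdx]
  -- main term
  have hV := polyAPSeq_densityProduct f N 1 0 z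
  -- remainder
  set Pu : ℕ := ∏ p ∈ Nat.primesBelow ⌈u₁⌉₊, p with hPu
  have hPupos : 0 < Pu := prod_pos fun p hp => (Nat.mem_primesBelow.mp hp).2.pos
  have hQprod : (∏ q ∈ Q, (q : ℝ)) ≤ (Pu : ℝ) := by
    have hdvd : (∏ q ∈ Q, q) ∣ Pu := prod_dvd_prod_of_subset _ _ _ fun p hp => by
      obtain ⟨hp1, hp2⟩ := mem_filter.mp hp
      exact Nat.mem_primesBelow.mpr ⟨Nat.lt_ceil.mpr hp2, (Nat.mem_primesBelow.mp hp1).2⟩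
    have hle : ((∏ q ∈ Q, q : ℕ) : ℝ) ≤ (Pu : ℝ) := by exact_mod_cast Nat.le_of_dvd hPupos hdvd
    simpa only [Nat.cast_prod] using hle
  have hR : ∑ d ∈ (primesProdBelow z).divisors.filter (fun d : ℕ => (d : ℝ) < z * ∏ q ∈ Q, (q : ℝ)),
      |(polyAPSeq f N 1 0).remainder d x| ≤ C * (z * Pu) := by
    have hsub : (primesProdBelow z).divisors.filter (fun d : ℕ => (d : ℝ) < z * ∏ q ∈ Q, (q : ℝ)) ⊆
        Icc 1 ⌊z * (Pu : ℝ)⌋₊ := by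
      intro d hd
      obtain ⟨hdP, hdlt⟩ := mem_filter.mp hd
      rw [mem_Icc]
      refine ⟨Nat.pos_of_mem_divisors hdP, Nat.le_floor ?_⟩
      exact (hdlt.trans_le (mul_le_mul_of_nonneg_left hQprod hz0)).le
    calc ∑ d ∈ (primesProdBelow z).divisors.filter (fun d : ℕ => (d : ℝ) < z * ∏ q ∈ Q, (q : ℝ)),
          |(polyAPSeq f N 1 0).remainder d x|
        ≤ ∑ d ∈ (primesProdBelow z).divisors.filter (fun d : ℕ => (d : ℝ) < z * ∏ q ∈ Q, (q : ℝ)),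
            (polyRootCountMod ![f] d : ℝ) := by
          refine sum_le_sum fun d hd => ?_
          have hd0 : 0 < d := Nat.pos_of_mem_divisors (mem_filter.mp hd).1
          exact abs_remainder_polyAPSeq_le f (N := N) (q := 1) (r := 0) (m := d) one_pos hd0
            (Nat.coprime_one_left d) hxval
      _ ≤ ∑ d ∈ Icc 1 ⌊z * (Pu : ℝ)⌋₊, (polyRootCountMod ![f] d : ℝ) :=
          sum_le_sum_of_subset_of_nonneg hsub fun _ _ _ => Nat.cast_nonneg _
      _ ≤ C * (z * Pu) := hC _ (by
          have : (1 : ℝ) ≤ Pu := by exact_mod_cast hPupos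
          nlinarith)
  -- assemble
  rw [hV, hX] at hJR
  rw [← hsift]
  linarith [hJR, hR]

/-! ### `#{n ≤ N : |g(n)| is N^c-rough} ≤ (2 C(g) + δ) N / log N` -/

/-- **The sieve bound for the rough values of a Bateman–Horn polynomial.** For `g ∈ ℤ[X]` of degree
`≥ 2` forming a Bateman–Horn system and every `δ > 0` there is `0 < c < 1` with
`#{1 ≤ n ≤ N : |g(n)| coprime to ∏_{p < N^c} p} ≤ (2 C(g) + δ) N / log N` for all large `N`
(Jurkat–Richert with `F(1) = 2e^γ` at level `z = N^c`, `c → 1`, `ε → 0`, applied to a good translate). -/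
theorem exists_level_eventually_card_rough_le {g : ℤ[X]} (hg : IsBatemanHornSystem ![g])
    (hdeg : 2 ≤ g.natDegree) {δ : ℝ} (hδ : 0 < δ) :
    ∃ c : ℝ, 0 < c ∧ c < 1 ∧ ∀ᶠ N : ℕ in atTop,
      (#((Icc 1 N).filter fun n : ℕ =>
          ((g.eval (n : ℤ)).natAbs).Coprime (primesProdBelow ((N : ℝ) ^ c))) : ℝ)
        ≤ (2 * batemanHornConst ![g] + δ) * N / Real.log N := by
  -- the data of `g` and its translate `f(X) = g(X + n₀)`
  obtain ⟨𝔠, h𝔠def⟩ : ∃ 𝔠 : ℝ, 𝔠 = batemanHornConst ![g] := ⟨_, rfl⟩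
  have h𝔠 : 0 < 𝔠 := by rw [h𝔠def]; exact (IsBatemanHornSystem.hasBatemanHornConst_holds hg).2
  rw [← h𝔠def]
  have hirr : Irreducible g := by simpa using hg.irreducible 0
  have hlc : 0 < g.leadingCoeff := by simpa using hg.leadingCoeff_pos 0
  have hdeg0 : 0 < g.natDegree := by omega
  obtain ⟨n₀, hlow⟩ := exists_shift_lt_eval hdeg hlc
  obtain ⟨f, hf⟩ : ∃ f : ℤ[X], f = g.comp (X + C (n₀ : ℤ)) := ⟨_, rfl⟩
  have hfeval : ∀ m : ℤ, f.eval m = g.eval (m + n₀) := fun m => by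
    rw [hf, eval_comp, eval_add, eval_X, eval_C]
  have hfevalN : ∀ m : ℕ, f.eval (m : ℤ) = g.eval ((m + n₀ : ℕ) : ℤ) := fun m => by
    rw [hfeval]; push_cast; rfl
  have hρ : ∀ p : ℕ, polyRootCountMod ![f] p = polyRootCountMod ![g] p := fun p => by
    rw [hf]; exact polyRootCountMod_comp_X_add_C g (n₀ : ℤ) p
  have hval : ∀ n : ℕ, 1 ≤ n → (n : ℤ) ≤ f.eval (n : ℤ) := by
    intro n hn
    rw [hfevalN]
    have h := hlow (n + n₀) (by omega)
    push_cast at h ⊢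
    linarith [(Nat.cast_nonneg n₀ : (0 : ℤ) ≤ n₀)]
  have hlt : ∀ p : ℕ, p.Prime → polyRootCountMod ![f] p < p := fun p hp => by
    rw [hρ]
    have h := rootCount_single_lt hg 0 hp
    simp only [Matrix.cons_val_fin_one] at h
    exact h
  -- `#R_g(N) ≤ #R_f(N) + n₀`
  have hcount : ∀ (N : ℕ) (z : ℝ),
      (#((Icc 1 N).filter fun n : ℕ => ((g.eval (n : ℤ)).natAbs).Coprime (primesProdBelow z)) : ℝ) ≤
        #((Icc 1 N).filter fun n : ℕ => ((f.eval (n : ℤ)).natAbs).Coprime (primesProdBelow z))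
          + n₀ := by
    intro N z
    exact_mod_cast card_filter_le_card_filter_shift_add hfevalN
      (fun m : ℕ => m.Coprime (primesProdBelow z)) N
  -- parameters: level exponent `c`, sieve parameter `ε`, slack `η`
  obtain ⟨c, hcdef⟩ : ∃ c : ℝ, c = 16 * 𝔠 / (16 * 𝔠 + δ) := ⟨_, rfl⟩
  have hc0 : 0 < c := by rw [hcdef]; positivity
  have hc1 : c < 1 := by rw [hcdef, div_lt_one (by positivity)]; linarith
  have hSc : 𝔠 * c⁻¹ = 𝔠 + δ / 16 := by rw [hcdef, inv_div]; field_simp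
  obtain ⟨ε, hεdef⟩ : ∃ ε : ℝ, ε = min (1 / 400) (δ / (Real.exp 13 * (16 * 𝔠 + δ))) := ⟨_, rfl⟩
  have hε : 0 < ε := by rw [hεdef]; exact lt_min (by norm_num) (by positivity)
  have hε' : ε < 1 / 200 := by rw [hεdef]; exact (min_le_left _ _).trans_lt (by norm_num)
  have hε13 : ε * Real.exp 13 * (𝔠 + δ / 16) ≤ δ / 16 := by
    have h1 : ε ≤ δ / (Real.exp 13 * (16 * 𝔠 + δ)) := by rw [hεdef]; exact min_le_right _ _
    calc ε * Real.exp 13 * (𝔠 + δ / 16)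
        ≤ δ / (Real.exp 13 * (16 * 𝔠 + δ)) * Real.exp 13 * (𝔠 + δ / 16) := by gcongr
      _ = δ / 16 := by field_simp
  have hcoef0 : 0 < 2 * Real.exp Real.eulerMascheroniConstant + ε * Real.exp 13 := by positivity
  obtain ⟨η, hηdef⟩ : ∃ η : ℝ,
      η = δ / (8 * (2 * Real.exp Real.eulerMascheroniConstant + ε * Real.exp 13)) := ⟨_, rfl⟩
  have hη : 0 < η := by rw [hηdef]; positivity
  -- the data: Mertens hypothesis (from the sieve condition for `ρ_g = ρ_f`), mean value, Mertens product
  obtain ⟨K, hK1, hK⟩ := rootCount_sieveConditionOne hg hdeg0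
  have hK' : ∀ w z : ℝ, 2 ≤ w → w < z →
      ∏ p ∈ (Nat.primesBelow ⌈z⌉₊).filter (fun p : ℕ => w ≤ (p : ℝ)),
          (1 - (polyRootCountMod ![f] p : ℝ) / p)⁻¹ ≤ Real.log z / Real.log w * (1 + K / Real.log w) := by
    intro w z hw hwz
    simp only [hρ]
    exact hK w z hw hwz
  obtain ⟨u₁, -, hMert⟩ := exists_hasMertensHypothesisBelow_polyAPSeq f hK1 hK' hε
  obtain ⟨C, hC0, hC⟩ := exists_sum_rootCount_le hirr hdeg0
  have hCf : ∀ y : ℝ, 2 ≤ y → ∑ m ∈ Icc 1 ⌊y⌋₊, (polyRootCountMod ![f] m : ℝ) ≤ C * y := by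
    intro y hy; simp only [hρ]; exact hC y hy
  obtain ⟨Pu, hPudef⟩ : ∃ Pu : ℕ, Pu = ∏ p ∈ Nat.primesBelow ⌈u₁⌉₊, p := ⟨_, rfl⟩
  have hPu1 : (1 : ℝ) ≤ Pu := by
    rw [hPudef]; exact_mod_cast prod_pos fun p hp => (Nat.mem_primesBelow.mp hp).2.pos
  have hEγ : Real.exp Real.eulerMascheroniConstant * Real.exp (-Real.eulerMascheroniConstant) = 1 := by
    rw [← Real.exp_add, add_neg_cancel, Real.exp_zero]
  have hEγ1 : Real.exp (-Real.eulerMascheroniConstant) ≤ 1 := by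
    rw [Real.exp_le_one_iff]
    have := Real.one_half_lt_eulerMascheroniConstant
    linarith
  have hVle : ∀ᶠ N : ℕ in atTop, Real.log N *
      ∏ p ∈ Nat.primesBelow ⌈(N : ℝ) ^ c⌉₊, (1 - (polyRootCountMod ![g] p : ℝ) / p) ≤
        𝔠 * Real.exp (-Real.eulerMascheroniConstant) * c⁻¹ + η := by
    have h := tendsto_log_mul_prod_one_sub_rootCount_div_rpow hg hc0
    rw [← h𝔠def] at h
    exact h.eventually_le_const (by linarith)
  -- the main-term constant: `(2e^γ + ε e^{13}) (𝔠 e^{-γ}/c + η) ≤ 2𝔠 + 5δ/16`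
  have hcoefB : (2 * Real.exp Real.eulerMascheroniConstant + ε * Real.exp 13) *
      (𝔠 * Real.exp (-Real.eulerMascheroniConstant) * c⁻¹ + η) ≤ 2 * 𝔠 + 5 * δ / 16 := by
    have h1 : (2 * Real.exp Real.eulerMascheroniConstant + ε * Real.exp 13) *
        (𝔠 * Real.exp (-Real.eulerMascheroniConstant) * c⁻¹ + η)
        = 2 * (𝔠 * c⁻¹) *
            (Real.exp Real.eulerMascheroniConstant * Real.exp (-Real.eulerMascheroniConstant))
          + ε * Real.exp 13 * (𝔠 * c⁻¹) * Real.exp (-Real.eulerMascheroniConstant)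
          + (2 * Real.exp Real.eulerMascheroniConstant + ε * Real.exp 13) * η := by ring
    have h2 : (2 * Real.exp Real.eulerMascheroniConstant + ε * Real.exp 13) * η = δ / 8 := by
      rw [hηdef]; field_simp
    rw [h1, hEγ, hSc, h2]
    have h3 : ε * Real.exp 13 * (𝔠 + δ / 16) * Real.exp (-Real.eulerMascheroniConstant) ≤ δ / 16 * 1 :=
      mul_le_mul hε13 hEγ1 (Real.exp_pos _).le (by positivity)
    linarith
  -- the remainder and the shift are `o(N / log N)`: `log N ≤ α N^{1-c}` eventually
  have hCP : 0 < C * Pu + (n₀ + 1) := by positivity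
  obtain ⟨α, hαdef⟩ : ∃ α : ℝ, α = δ / (2 * (C * Pu + (n₀ + 1))) := ⟨_, rfl⟩
  have hα : 0 < α := by rw [hαdef]; positivity
  have hαid : (C * Pu + (n₀ + 1)) * α = δ / 2 := by rw [hαdef]; field_simp
  have hlog : ∀ᶠ N : ℕ in atTop, Real.log N ≤ α * (N : ℝ) ^ (1 - c) := by
    have h := (isLittleO_log_rpow_atTop (by linarith : (0 : ℝ) < 1 - c)).bound hα
    filter_upwards [tendsto_natCast_atTop_atTop.eventually h, eventually_ge_atTop 1] with N hN hN1
    have hN' : (1 : ℝ) ≤ N := by exact_mod_cast hN1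
    rwa [Real.norm_of_nonneg (Real.log_nonneg hN'),
      Real.norm_of_nonneg (Real.rpow_nonneg (by linarith) _)] at hN
  have hz2 : ∀ᶠ N : ℕ in atTop, (2 : ℝ) ≤ (N : ℝ) ^ c :=
    ((tendsto_rpow_atTop hc0).comp tendsto_natCast_atTop_atTop).eventually_ge_atTop 2
  refine ⟨c, hc0, hc1, ?_⟩
  filter_upwards [hVle, hlog, hz2, eventually_ge_atTop 2] with N hVN hlogN hz hN2
  have hN : (2 : ℝ) ≤ N := by exact_mod_cast hN2
  have hN0 : (0 : ℝ) < N := by linarith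
  have hlog0 : 0 < Real.log N := Real.log_pos (by linarith)
  have h := card_roughValues_le_sieve f hlt hval hε hε' hz N (hMert N _) hCf
  rw [← hPudef] at h
  simp only [hρ] at h
  have hcN := hcount N ((N : ℝ) ^ c)
  have hz1 : ((n₀ : ℝ) + 1) ≤ ((n₀ : ℝ) + 1) * (N : ℝ) ^ c :=
    le_mul_of_one_le_right (by positivity) (by linarith)
  rw [le_div_iff₀ hlog0]
  have hsplit : (N : ℝ) ^ c * (N : ℝ) ^ (1 - c) = N := by
    rw [← Real.rpow_add hN0, add_sub_cancel, Real.rpow_one]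
  calc (#((Icc 1 N).filter fun n : ℕ =>
          ((g.eval (n : ℤ)).natAbs).Coprime (primesProdBelow ((N : ℝ) ^ c))) : ℝ) * Real.log N
      ≤ ((2 * Real.exp Real.eulerMascheroniConstant + ε * Real.exp 13) *
            ((∏ p ∈ Nat.primesBelow ⌈(N : ℝ) ^ c⌉₊, (1 - (polyRootCountMod ![g] p : ℝ) / p)) * N)
          + C * ((N : ℝ) ^ c * Pu) + ((n₀ : ℝ) + 1) * (N : ℝ) ^ c) * Real.log N := by
        apply mul_le_mul_of_nonneg_right _ hlog0.le
        linarith [h, hcN, hz1]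
    _ = (2 * Real.exp Real.eulerMascheroniConstant + ε * Real.exp 13) *
            (Real.log N * ∏ p ∈ Nat.primesBelow ⌈(N : ℝ) ^ c⌉₊,
              (1 - (polyRootCountMod ![g] p : ℝ) / p)) * N
          + (C * Pu + (n₀ + 1)) * ((N : ℝ) ^ c * Real.log N) := by ring
    _ ≤ (2 * Real.exp Real.eulerMascheroniConstant + ε * Real.exp 13) *
            (𝔠 * Real.exp (-Real.eulerMascheroniConstant) * c⁻¹ + η) * N
          + (C * Pu + (n₀ + 1)) * ((N : ℝ) ^ c * (α * (N : ℝ) ^ (1 - c))) := by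
        gcongr
    _ = (2 * Real.exp Real.eulerMascheroniConstant + ε * Real.exp 13) *
            (𝔠 * Real.exp (-Real.eulerMascheroniConstant) * c⁻¹ + η) * N
          + (C * Pu + (n₀ + 1)) * α * N := by
        rw [mul_left_comm ((N : ℝ) ^ c) α, hsplit]; ring
    _ ≤ (2 * 𝔠 + 5 * δ / 16) * N + δ / 2 * N := by
        rw [hαid]; gcongr
    _ ≤ (2 * 𝔠 + δ) * N := by
        have : 0 ≤ δ * N := by positivity
        linarith

end Summit.Parity.BatemanHorn.Theorems
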